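import Summits.Ventures.HodgeRepro2.T6Interface
import Summits.Ventures.HodgeRepro2.T6A3ExtBC

/-!
# T6-A3 — the complexification of the transfer shadow (lead's ruling, STATUS l. 4259)

Tier 6 (README §10), sub-goal A3, seat t6-p3; proof lane.  `T6Interface` v0 carries the pairing
data of the corner product `B` rationally — `intB : HB K →ₗ[ℚ] ℚ`, `intBB : HBB K →ₗ[ℚ] ℚ`,
`cop = m^* : HB K →ₐ[ℚ] HBB K`, the Pontryagin product `pont` with `pont_spec`, the Gysin class `z`
with `z_proj`.  The pairing identity of TIER4 §A5 lives in the complex eigenbasis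
(`T6A3Pairing` / `T6A3PairingKappa` over `HBC K = ⋀_ℂ H¹(B, ℂ)`).  This file DEFINES, over a
transfer shadow `D`, the ℂ-extensions

* `intBC D : HBC K →ₗ[ℂ] ℂ` with `intBC D (extC K a) = (D.intB a : ℂ)`,
* `HBBC K := ⋀_ℂ(ℂ ⊗ H¹) ᵍ⊗[ℂ] ⋀_ℂ(ℂ ⊗ H¹)` (the model of `H^*(B × B, ℂ)`), the inclusions
  `inlC K`, `inrC K : HBC K →ₐ[ℂ] HBBC K`, the base change `ofBB K : HBB K →ₐ[ℚ] HBBC K`,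
* `intBBC D : HBBC K →ₗ[ℂ] ℂ` (Fubini by construction) with `intBBC D (ofBB K x) = (D.intBB x : ℂ)`,
* `copC K : HBC K →ₐ[ℂ] HBBC K` (`ι w ↦ ι w ⊗ 1 + 1 ⊗ ι w`) with `copC K (extC K a) = ofBB K (D.cop a)`,

and PROVES the transported identities: Fubini `intBBC D (inlC K a * inrC K b) = intBC D a * intBC D b`,
the Pontryagin pairing `intBC D (extC K (D.pont a b) * u) = intBBC D (inlC K (extC K a) * inrC K
(extC K b) * copC K u)` for every complex `u`, and the projection formula
`intBC D (extC K D.z * u) = D.intS (D.pull u)` for every complex `u`.  All of it is the uniqueness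
half of the universal property of base change (`T6A3ExtBC.ext_of_ofR`): the two sides are
ℂ-linear and agree on the rational classes.

The identification used: `HBC K = ⋀_ℂ (Fin 4 → ℂ ⊗[ℚ] K)` is `⋀_ℂ (ℂ ⊗[ℚ] (Fin 4 → K))` through
`TensorProduct.piRight`, and under it `extC K` is the coefficient extension `ofR` of `T6A3ExtBC`.
Nothing here is a display.
-/

open scoped TensorProduct

namespace Summit.Ventures.HodgeRepro2.T6.A3BaseChange

open A3ExtBC

variable (K : Type*) [Field K] [NumberField K]

/-! ## 1. `HBC K` as the base change of `HB K` -/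

/-- `ℂ ⊗[ℚ] (Fin 4 → K) ≃ₗ[ℂ] (Fin 4 → ℂ ⊗[ℚ] K)` (Mathlib's `TensorProduct.piRight`). -/
noncomputable def h1Equiv : ℂ ⊗[ℚ] H1 K ≃ₗ[ℂ] H1C K :=
  TensorProduct.piRight ℚ ℂ ℂ (fun _ : Fin 4 => K)

/-- `h1Equiv (c ⊗ v) = (i ↦ c ⊗ v i)`. -/
theorem h1Equiv_tmul (c : ℂ) (v : H1 K) : h1Equiv K (c ⊗ₜ[ℚ] v) = fun i => c ⊗ₜ[ℚ] v i := by
  simp [h1Equiv, TensorProduct.piRight_apply]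

/-- The isometry of zero quadratic forms induced by `h1Equiv`. -/
noncomputable def h1Isometry :
    (0 : QuadraticForm ℂ (ℂ ⊗[ℚ] H1 K)).IsometryEquiv (0 : QuadraticForm ℂ (H1C K)) :=
  { h1Equiv K with map_app' := fun _ => rfl }

/-- `⋀_ℂ (ℂ ⊗[ℚ] H¹(B, ℚ)) ≃ₐ[ℂ] HBC K`, the exterior-algebra isomorphism induced by `h1Equiv`. -/
noncomputable def hbcEquiv : ExteriorAlgebra ℂ (ℂ ⊗[ℚ] H1 K) ≃ₐ[ℂ] HBC K :=
  CliffordAlgebra.equivOfIsometry (h1Isometry K)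

/-- `hbcEquiv (ι x) = ι (h1Equiv x)`. -/
theorem hbcEquiv_ι (x : ℂ ⊗[ℚ] H1 K) :
    hbcEquiv K (ExteriorAlgebra.ι ℂ x) = ExteriorAlgebra.ι ℂ (h1Equiv K x) := by
  unfold hbcEquiv
  rw [CliffordAlgebra.equivOfIsometry_apply, ExteriorAlgebra.ι, CliffordAlgebra.map_apply_ι]
  rfl

/-- The lead's coefficient extension `extC K` IS the toolkit's `ofR` transported by `hbcEquiv`. -/
theorem extC_eq : extC K = (((hbcEquiv K).toAlgHom.restrictScalars ℚ).comp (ofR ℚ ℂ (H1 K))) := by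
  apply ExteriorAlgebra.hom_ext
  refine LinearMap.ext fun v => ?_
  simp only [LinearMap.comp_apply, AlgHom.toLinearMap_apply, AlgHom.comp_apply,
    AlgHom.coe_restrictScalars', ofR_ι]
  have h : (hbcEquiv K).toAlgHom (ExteriorAlgebra.ι ℂ ((1 : ℂ) ⊗ₜ[ℚ] v)) =
      ExteriorAlgebra.ι ℂ (fun i => (1 : ℂ) ⊗ₜ[ℚ] v i) := by
    change hbcEquiv K (ExteriorAlgebra.ι ℂ ((1 : ℂ) ⊗ₜ[ℚ] v)) = _
    rw [hbcEquiv_ι, h1Equiv_tmul]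
  rw [h]
  unfold extC
  rw [ExteriorAlgebra.lift_ι_apply]
  rfl

/-- `extC K a = hbcEquiv (ofR a)`. -/
theorem extC_apply (a : HB K) : extC K a = hbcEquiv K (ofR ℚ ℂ (H1 K) a) := by
  rw [extC_eq]
  rfl

/-- `HBC K` is the base change of `HB K` along `extC K` (Mathlib's `IsBaseChange`). -/
theorem isBaseChange_extC : IsBaseChange ℂ (extC K).toLinearMap := by
  refine IsBaseChange.of_equiv
    ((extBC ℚ ℂ (H1 K)).symm.toLinearEquiv.trans (hbcEquiv K).toLinearEquiv) fun a => ?_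
  change hbcEquiv K ((extBC ℚ ℂ (H1 K)).symm ((1 : ℂ) ⊗ₜ[ℚ] a)) = extC K a
  rw [extC_apply, ofR_apply]

/-- Two ℂ-linear maps out of `HBC K` agreeing on the rational classes `extC K a` agree. -/
theorem ext_of_extC {Q : Type*} [AddCommMonoid Q] [Module ℂ Q] (g₁ g₂ : HBC K →ₗ[ℂ] Q)
    (h : ∀ a : HB K, g₁ (extC K a) = g₂ (extC K a)) : g₁ = g₂ :=
  (isBaseChange_extC K).algHom_ext g₁ g₂ h

/-! ## 2. The complex integral `intBC`, the model `HBBC` of `H^*(B × B, ℂ)` and its integral -/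

variable {K}
variable {F : FaceSetting K} (D : TransferShadow F)

/-- `∫_B` on `H^*(B, ℂ)`: the ℂ-linear extension of `D.intB`. -/
noncomputable def intBC : HBC K →ₗ[ℂ] ℂ :=
  (isBaseChange_extC K).lift (Algebra.linearMap ℚ ℂ ∘ₗ D.intB)

/-- The rationality link: `intBC D (extC K a) = (D.intB a : ℂ)`. -/
theorem intBC_extC (a : HB K) : intBC D (extC K a) = (D.intB a : ℂ) :=
  (isBaseChange_extC K).lift_eq (Algebra.linearMap ℚ ℂ ∘ₗ D.intB) a

variable (K) in
/-- `H^*(B × B, ℂ) = ⋀_ℂ(ℂ ⊗ H¹) ᵍ⊗[ℂ] ⋀_ℂ(ℂ ⊗ H¹)` (the toolkit's `TT_S`). -/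
abbrev HBBC := TT_S ℚ ℂ (H1 K)

variable (K) in
/-- `pr₁^* : H^*(B, ℂ) → H^*(B × B, ℂ)`. -/
noncomputable def inlC : HBC K →ₐ[ℂ] HBBC K :=
  (GradedTensorProduct.includeLeft (gradS ℚ ℂ (H1 K)) (gradS ℚ ℂ (H1 K))).comp
    (hbcEquiv K).symm.toAlgHom

variable (K) in
/-- `pr₂^* : H^*(B, ℂ) → H^*(B × B, ℂ)`. -/
noncomputable def inrC : HBC K →ₐ[ℂ] HBBC K :=
  (GradedTensorProduct.includeRight (gradS ℚ ℂ (H1 K)) (gradS ℚ ℂ (H1 K))).comp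
    (hbcEquiv K).symm.toAlgHom

variable (K) in
/-- The base change `HBB K →ₐ[ℚ] HBBC K` of the graded tensor product (`ofRTT` of the toolkit;
`HBB K` is literally `TT_R ℚ (H1 K)`). -/
noncomputable def ofBB : HBB K →ₐ[ℚ] HBBC K := ofRTT ℚ ℂ (H1 K)

/-- `ofBB (pr₁^* a) = pr₁^* (extC a)`. -/
theorem ofBB_inl (a : HB K) : ofBB K (inl K a) = inlC K (extC K a) := by
  unfold ofBB inl inlC
  rw [ofRTT_includeLeft, AlgHom.comp_apply, extC_apply]
  simp

/-- `ofBB (pr₂^* b) = pr₂^* (extC b)`. -/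
theorem ofBB_inr (b : HB K) : ofBB K (inr K b) = inrC K (extC K b) := by
  unfold ofBB inr inrC
  rw [ofRTT_includeRight, AlgHom.comp_apply, extC_apply]
  simp

/-- `∫_{B × B}` on `H^*(B × B, ℂ)`: the product functional `x ⊗ y ↦ ∫_B x · ∫_B y` (Fubini by
construction, TIER4 (A5.2.0)). -/
noncomputable def intBBC : HBBC K →ₗ[ℂ] ℂ :=
  intTT ℚ ℂ (H1 K) (intBC D ∘ₗ (hbcEquiv K).toLinearMap)

/-- Fubini on the complex carrier: `∫_{B × B} (pr₁^* a ∪ pr₂^* b) = ∫_B a · ∫_B b`. -/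
theorem intBBC_inlC_mul_inrC (a b : HBC K) :
    intBBC D (inlC K a * inrC K b) = intBC D a * intBC D b := by
  unfold intBBC inlC inrC
  rw [AlgHom.comp_apply, AlgHom.comp_apply, GradedTensorProduct.includeLeft_apply,
    GradedTensorProduct.includeRight_apply, GradedTensorProduct.tmul_one_mul_one_tmul, intTT_tmul]
  simp only [LinearMap.comp_apply, AlgEquiv.toLinearMap_apply]
  change intBC D (hbcEquiv K ((hbcEquiv K).symm a)) * intBC D (hbcEquiv K ((hbcEquiv K).symm b)) = _
  rw [AlgEquiv.apply_symm_apply, AlgEquiv.apply_symm_apply]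

/-- The rationality link for `∫_{B × B}`: `intBBC D (ofBB K x) = (D.intBB x : ℂ)`. -/
theorem intBBC_ofBB (x : HBB K) : intBBC D (ofBB K x) = (D.intBB x : ℂ) := by
  have hext : intBC D ∘ₗ (hbcEquiv K).toLinearMap = extFun ℚ ℂ (H1 K) D.intB := by
    apply ext_of_ofR
    intro a
    simp only [LinearMap.comp_apply, AlgEquiv.toLinearMap_apply, extFun_ofR]
    rw [← extC_apply, intBC_extC]
    rfl
  unfold intBBC ofBB
  rw [hext]
  refine intTT_ofRTT D.intB D.intBB (fun a b => ?_) x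
  rw [← D.intBB_tmul]
  congr 1
  unfold inl inr
  rw [GradedTensorProduct.includeLeft_apply, GradedTensorProduct.includeRight_apply,
    GradedTensorProduct.tmul_one_mul_one_tmul]

/-! ## 3. The complex coproduct `m^*` and the transported identities -/

variable (K) in
/-- `m^* : H^*(B, ℂ) → H^*(B × B, ℂ)`, the coproduct `ι w ↦ ι w ⊗ 1 + 1 ⊗ ι w` (TIER4 (A5.1.1)). -/
noncomputable def copC : HBC K →ₐ[ℂ] HBBC K :=
  (copS ℚ ℂ (H1 K)).comp (hbcEquiv K).symm.toAlgHom

/-- The rationality link for `m^*`: `copC K (extC K a) = ofBB K (D.cop a)`. -/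
theorem copC_extC (a : HB K) : copC K (extC K a) = ofBB K (D.cop a) := by
  unfold copC ofBB
  rw [AlgHom.comp_apply, extC_apply]
  change copS ℚ ℂ (H1 K) ((hbcEquiv K).symm (hbcEquiv K (ofR ℚ ℂ (H1 K) a))) = _
  rw [AlgEquiv.symm_apply_apply]
  exact copS_ofR D.cop D.cop_ι a

/-- `m^*` on degree one, complex form: `copC (ι w) = pr₁^* (ι w) + pr₂^* (ι w)`. -/
theorem copC_ι (w : H1C K) :
    copC K (ExteriorAlgebra.ι ℂ w) = inlC K (ExteriorAlgebra.ι ℂ w) + inrC K (ExteriorAlgebra.ι ℂ w) := by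
  obtain ⟨x, rfl⟩ := (h1Equiv K).surjective w
  have h1 : (hbcEquiv K).symm.toAlgHom (ExteriorAlgebra.ι ℂ (h1Equiv K x)) =
      ExteriorAlgebra.ι ℂ x := by
    change (hbcEquiv K).symm (ExteriorAlgebra.ι ℂ (h1Equiv K x)) = _
    rw [← hbcEquiv_ι, AlgEquiv.symm_apply_apply]
  unfold copC inlC inrC
  rw [AlgHom.comp_apply, AlgHom.comp_apply, AlgHom.comp_apply, h1, copS_ι]

/-- THE PONTRYAGIN PAIRING on the complex carrier (TIER4 (A5.2), the (PF) step for `m`): for rational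
`a, b` and EVERY complex `u`, `∫_B (a ⋆ b) ∪ u = ∫_{B × B} (pr₁^* a ∪ pr₂^* b) ∪ m^* u`. -/
theorem pont_spec_C (a b : HB K) (u : HBC K) :
    intBC D (extC K (D.pont a b) * u) =
      intBBC D (inlC K (extC K a) * inrC K (extC K b) * copC K u) := by
  have key : intBC D ∘ₗ LinearMap.mulLeft ℂ (extC K (D.pont a b)) =
      intBBC D ∘ₗ LinearMap.mulLeft ℂ (inlC K (extC K a) * inrC K (extC K b)) ∘ₗ
        (copC K).toLinearMap := by
    apply ext_of_extC
    intro u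
    simp only [LinearMap.comp_apply, LinearMap.mulLeft_apply, AlgHom.toLinearMap_apply]
    rw [copC_extC D, ← ofBB_inl, ← ofBB_inr]
    rw [← map_mul (ofBB K), ← map_mul (ofBB K), intBBC_ofBB, ← map_mul (extC K), intBC_extC,
      D.pont_spec]
  have := LinearMap.congr_fun key u
  simp only [LinearMap.comp_apply, LinearMap.mulLeft_apply, AlgHom.toLinearMap_apply] at this
  exact this

/-- THE PROJECTION FORMULA on the complex carrier (TIER4 (A4.1.1)): `∫_B z ∪ u = ∫_S f^* u` for
EVERY complex `u`. -/
theorem z_proj_C (u : HBC K) : intBC D (extC K D.z * u) = D.intS (D.pull u) := by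
  have key : intBC D ∘ₗ LinearMap.mulLeft ℂ (extC K D.z) = D.intS ∘ₗ (D.pull).toLinearMap := by
    apply ext_of_extC
    intro u
    simp only [LinearMap.comp_apply, LinearMap.mulLeft_apply, AlgHom.toLinearMap_apply]
    rw [← map_mul, intBC_extC, D.z_proj]
  have := LinearMap.congr_fun key u
  simp only [LinearMap.comp_apply, LinearMap.mulLeft_apply, AlgHom.toLinearMap_apply] at this
  exact this

end Summit.Ventures.HodgeRepro2.T6.A3BaseChange
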